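import Literature.AlgebraicGeometry.HodgeTheory.LocalKernelConnected
import Summits.HodgeConjecture.HodgeConjecture.Theorems.LinearSystemTorelliLocalTubeSpanConj

/-!
# Route LinearSystemTorelli — crux `LocalTubeSpan` (stmt-HodgeConjecture-2490): the typed surrogate from one view point

Composition file (`--supports stmt-HodgeConjecture-2490`, line `Sketch` of the crux chain, cycle 4
wave 4).  The tree's `localKernelOn ι V s N` and the line's "undetected on every local subgroup at
`N`" are infima over ALL view points `s' ∈ ι⁻¹ N` and all paths `γ` to the base point.  On a
path-connected piece `ι⁻¹ N` (a punctured ball `B ∖ Δ`) the local subgroups are conjugate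
(`Literature…LocalKernelConnected.localSubgroup_eq_conj_smul`; the line's
`localTubeSpan_localSubgroup_conj_of_joinedIn`), the restriction kernels agree
(`localKernelOn_eq_H1resKer`, Literature) and so do the kernels of Schnell's third map on them
(`localTubeSpan_ker_evalCoinvOn_conj_smul`, file `…Conj`).  Hence:

* `localTubeSpan_iInf_ker_evalCoinvOn_eq_of_isPathConnected` — "undetected on every local subgroup
  at `N`" = "undetected on one of them";
* `localTubeSpan_localKernelOn_eq_iInf_ker_of_one` — the typed surrogate of the crux at `N`
  (`localKernelOn ι V s N = ⨅ ker evalCoinvOn`, the shape of `…LocalKernel` /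
  `Lines/SketchTypedCandidate.lean`) follows from the algebraic surrogate
  `ker (evalCoinvOn _ S₀) = H1resKer _ S₀` at a SINGLE local subgroup `S₀` — so every injectivity
  theorem of the line, applied once (e.g. at the Brieskorn–Gabrielov presentation seen from one base
  point of the punctured ball), yields the typed statement at `N`.

No named facts; pure composition of tree lemmas.
-/

-- `Summit.HodgeConjecture.HodgeConjecture.Theorems` is the mandated namespace (single-conjunct summit:
-- Sub = Summit), which `linter.dupNamespace` flags on every declaration; the lakefile turns the
-- linter off tree-wide (weak option), restated here so stand-alone elaboration is warning-free too.
set_option linter.dupNamespace false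

noncomputable section

open CategoryTheory groupCohomology
open scoped Pointwise
open Literature.AlgebraicGeometry.HodgeTheory

namespace Summit.HodgeConjecture.HodgeConjecture.Theorems

universe u v

variable {k S : Type u} [CommRing k] [TopologicalSpace S] {T : Type v} [TopologicalSpace T]
  (ι : C(S, T)) (V : Literature.AlgebraicGeometry.Motives.LocalSystem k S) (s : S)

/-- **Undetected on one local subgroup is undetected on all** (path-connected piece).  If `ι⁻¹ N`
is path connected then the intersection over all view points `s₂` and paths `γ₂` of the kernels of
Schnell's third map on `localSubgroup ι s N hs₂ γ₂` is the kernel on any single one: conjugate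
subgroups have the same kernel (`localTubeSpan_ker_evalCoinvOn_conj_smul`).
[cite: HatcherAT2002, §1.1 Prop. 1.5] -/
theorem localTubeSpan_iInf_ker_evalCoinvOn_eq_of_isPathConnected (N : Set T)
    (hN : IsPathConnected (ι ⁻¹' N)) {s' : S} (hs' : ι s' ∈ N) (γ : Path s' s) :
    (⨅ (s₂ : S) (hs₂ : ι s₂ ∈ N) (γ₂ : Path s₂ s),
      LinearMap.ker (evalCoinvOn (monodromyRepObj V s) (localSubgroup ι s N hs₂ γ₂))) =
      LinearMap.ker (evalCoinvOn (monodromyRepObj V s) (localSubgroup ι s N hs' γ)) := by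
  refine le_antisymm (iInf_le_of_le s' (iInf_le_of_le hs' (iInf_le _ γ))) ?_
  refine le_iInf fun s₂ => le_iInf fun hs₂ => le_iInf fun γ₂ => ?_
  have hj : JoinedIn (ι ⁻¹' N) s' s₂ := hN.joinedIn s' hs' s₂ hs₂
  rw [localSubgroup_eq_conj_smul ι s hs' hs₂ hj.somePath
    (Set.range_subset_iff.2 hj.somePath_mem) γ γ₂, localTubeSpan_ker_evalCoinvOn_conj_smul]

/-- **The typed surrogate at a piece from ONE view point.**  If `ι⁻¹ N` is path connected and the
algebraic surrogate `ker (evalCoinvOn _ S₀) = H1resKer _ S₀` holds for one local subgroup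
`S₀ = localSubgroup ι s N hs' γ`, then the tree's `localKernelOn ι V s N` is exactly the space of
classes undetected on all local subgroups at `N`. [cite: BrosnanFangNiePearlstein2009, §1 eq. (1)] -/
theorem localTubeSpan_localKernelOn_eq_iInf_ker_of_one (N : Set T) (hN : IsPathConnected (ι ⁻¹' N))
    {s' : S} (hs' : ι s' ∈ N) (γ : Path s' s)
    (h : LinearMap.ker (evalCoinvOn (monodromyRepObj V s) (localSubgroup ι s N hs' γ)) =
      H1resKer (monodromyRepObj V s) (localSubgroup ι s N hs' γ)) :
    localKernelOn ι V s N = ⨅ (s₂ : S) (hs₂ : ι s₂ ∈ N) (γ₂ : Path s₂ s),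
      LinearMap.ker (evalCoinvOn (monodromyRepObj V s) (localSubgroup ι s N hs₂ γ₂)) := by
  rw [localTubeSpan_iInf_ker_evalCoinvOn_eq_of_isPathConnected ι V s N hN hs' γ, h,
    localKernelOn_eq_H1resKer ι s V hN hs' γ]

end Summit.HodgeConjecture.HodgeConjecture.Theorems

end
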